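import Summits.HodgeConjecture.HodgeConjecture.Theorems.Ring2WeilCoverageCyclotomicRealUnits
import HarnessLib

/-!
# Weil-type family coverage — THEOREM L (ii) at `M = 21` by `decide` on cyclotomic-unit sign vectors: the census
# row `(ℚ(ζ₂₁), ℚ(√−7))` (W6.7.1) is UNCONDITIONALLY principally polarisable on `ℂ^Φ/Φ(ℤ[ζ₂₁])`

research route conditional on HC_CM; not a corollary; Q11.4-sentence-2 already refuted in dim ≥ 3.

Ring 2, WEIL-TYPE FAMILY-COVERAGE CENSUS (`HOME/WEIL-FAMILY-COVERAGE.md` `## b01`, blocks b01.23 (A)/(C)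
«(ℚ(ζ₂₁), ℚ(√−7)) YES (W6.7.1) — the class of the Fermat sixfold (42; 1, 14, 27)», b01.28 THEOREM L (ii); owner
ring2-b01), part 12 of the `Ring2WeilCoverage*` series.  Part 7's YES theorem
(`CyclotomicPrincipalObstruction.exists_principal_twentyOne_sqrt_neg_seven`) was modulo `hU'` (every even sign
pattern is a real unit's); here that hypothesis is DISCHARGED at `M = 21` with the units of part 11:

* §1 `cover_even_patterns_twentyOne` (`decide`): at the six real places of `ℚ(ζ₂₁)⁺` (residues `1, 2, 4, 5, 8, 10`
  up to sign) the sign vectors of the cyclotomic units `c_2, c_4, c_5, c_8, c_{10}` together with `−1` produce, on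
  every `ℚ(√−7)`-balanced CM type set (one of `±r_i` per place), exactly the pattern «negative at `t` iff
  `t ∈ N_odd = {1, 4, 8, 11, 16, 19}`»; `exists_signs_of_isCMTypeSet`: every CM type set of `(ℤ/21)ˣ` is
  `{±r_i}` for a sign choice `e : Fin 6 → Bool`.
* §2 **`exists_principal_twentyOne` — UNCONDITIONAL**: for any `K` with `IsCyclotomicExtension {21} ℚ K`,
  `[IsCMField K]`, and any CM type `Φ` balanced for `N_{√−7} = {5, 10, 13, 17, 19, 20}`,
  **`∃ ζ′, ζ′^ρ = −ζ′ ∧ (∀ φ ∈ Φ, Im φ(ζ′) > 0) ∧ CMTypeLattice.IsOfType 1 ζ′ ⊤`** — the principal CM torus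
  `ℂ^Φ/Φ(ℤ[ζ₂₁])` CARRIES a `Φ`-positive divisor of principal type, i.e. an `ι`-compatible PRINCIPAL polarisation:
  `ζ′ = u·ξ` with `ξ = ζ⁵/Φ₂₁′(ζ)` (parts 6′/7) and `u = ± ∏_{a∈A} c_a` the unit whose signs at `Φ` match those of
  `Im φ(ξ)` (parts 6/11).

HONEST FRAMING: with part 9's `not_exists_principal_twentyOne` BOTH census rows of level 21 are now hypothesis-free
tree theorems (NO for `√−3`-balanced `Φ`, YES for `√−7`-balanced `Φ`); the identification `N_{√−7} =` «residues
acting as conjugation on `√−7`» is docstring-level as in part 9; statements about Shimura's divisors of principal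
type on the principal CM torus; nothing about Hodge classes, `W_K`, general members or HC; `HC_CM` is used nowhere.
No `def`, no named fact, no `sorry`.

References: [cite: Shimura1998, §14.3 Prop. 4–5, pp. 103–104]; [cite: Washington1997, §8.1]; census b01.23 / b01.28
(seat-derived).
-/

noncomputable section

open Polynomial NumberField Complex Finset
open scoped Real nonZeroDivisors

namespace Summit.HodgeConjecture.Ring2WeilCoverage.CyclotomicTwentyOneSignatures

open Literature.AlgebraicGeometry.Motives (CMType)
open Literature.AlgebraicGeometry.HodgeTheory (IsCMTypeSet)
open Literature.AlgebraicGeometry.ComplexMultiplication.CyclotomicCMType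
  (exists_apply_eq_toCircle isCMTypeSet_residueFilter)
open Literature.NumberTheory.ComplexMultiplication
open Summit.HodgeConjecture.Ring2WeilCoverage.CyclotomicDifferent (xi_ne_zero isOfType_one_xi_top)
open Summit.HodgeConjecture.Ring2WeilCoverage.CyclotomicPrincipalObstruction (complexConj_xi im_embedding_xi_neg_iff)
open Summit.HodgeConjecture.Ring2WeilCoverage.CMUnitSignature (exists_pos_isOfType_iff_exists_units)
open Summit.HodgeConjecture.Ring2WeilCoverage.CMTypeSignParity (im_embedding_ne_zero_of_skew)
open Summit.HodgeConjecture.Ring2WeilCoverage.CMTypeSetOddPositions (nodd_twentyOne_eq)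
open Summit.HodgeConjecture.Ring2WeilCoverage.CyclotomicRealUnits

variable {K : Type} [Field K] [NumberField K] {ζ : K}

/-! ### §1 The combinatorial core and the structure of CM type sets mod 21 -/

/-- **The sign vectors of `±c_2^{α₂}c_4^{α₄}c_5^{α₅}c_8^{α₈}c_{10}^{α₁₀}` cover the census pattern on every
`ℚ(√−7)`-balanced CM type set** of `(ℤ/21)ˣ` (written as `{±r_i}`, `r = (1,2,4,5,8,10)`, by a sign choice `e`):
there are `A ⊆ {2,4,5,8,10}` and a sign `ε` with «`#{a ∈ A : Xor (21 < 2(at mod 21)) (21 < 2t)} + [ε]` odd ⟺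
`t ∈ {1,4,8,11,16,19}`» for every `t` in the set — by `decide` (64 sign choices × 64 units × 6 residues).
research route conditional on HC_CM; not a corollary; Q11.4-sentence-2 already refuted in dim ≥ 3. [folklore] -/
theorem cover_even_patterns_twentyOne :
    ∀ e : Fin 6 → Bool,
      2 * ((Finset.univ.image fun i : Fin 6 =>
              if e i then (![1, 2, 4, 5, 8, 10] : Fin 6 → ZMod 21) i
              else -(![1, 2, 4, 5, 8, 10] : Fin 6 → ZMod 21) i) ∩
            ({5, 10, 13, 17, 19, 20} : Finset (ZMod 21))).card =
        (Finset.univ.image fun i : Fin 6 =>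
              if e i then (![1, 2, 4, 5, 8, 10] : Fin 6 → ZMod 21) i
              else -(![1, 2, 4, 5, 8, 10] : Fin 6 → ZMod 21) i).card →
      ∃ A ∈ ({2, 4, 5, 8, 10} : Finset ℕ).powerset, ∃ ε : Bool,
        ∀ t ∈ (Finset.univ.image fun i : Fin 6 =>
              if e i then (![1, 2, 4, 5, 8, 10] : Fin 6 → ZMod 21) i
              else -(![1, 2, 4, 5, 8, 10] : Fin 6 → ZMod 21) i),
          (Odd ((A.filter fun a => Xor (21 < 2 * ((a * t.val) % 21)) (21 < 2 * t.val)).card +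
              (if ε then 1 else 0)) ↔
            t ∈ ({1, 4, 8, 11, 16, 19} : Finset (ZMod 21))) := by
  decide

/-- **Every CM type set of `(ℤ/21)ˣ` is `{±r_i : i < 6}` for a sign choice** `e : Fin 6 → Bool`
(`r = (1, 2, 4, 5, 8, 10)`: every unit residue is `±r_i`, and a CM type set contains exactly one of `r_i, −r_i`).
research route conditional on HC_CM; not a corollary; Q11.4-sentence-2 already refuted in dim ≥ 3. [folklore] -/
theorem exists_signs_of_isCMTypeSet {T : Finset (ZMod 21)} (hT : IsCMTypeSet 21 T) :
    ∃ e : Fin 6 → Bool, T = Finset.univ.image fun i : Fin 6 =>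
      if e i then (![1, 2, 4, 5, 8, 10] : Fin 6 → ZMod 21) i else -(![1, 2, 4, 5, 8, 10] : Fin 6 → ZMod 21) i := by
  classical
  have hcover : ∀ t : ZMod 21, t.val.Coprime 21 →
      ∃ i : Fin 6, t = (![1, 2, 4, 5, 8, 10] : Fin 6 → ZMod 21) i ∨
        t = -(![1, 2, 4, 5, 8, 10] : Fin 6 → ZMod 21) i := by decide
  have hunit : ∀ i : Fin 6, ((![1, 2, 4, 5, 8, 10] : Fin 6 → ZMod 21) i).val.Coprime 21 := by decide
  refine ⟨fun i => decide ((![1, 2, 4, 5, 8, 10] : Fin 6 → ZMod 21) i ∈ T), ?_⟩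
  ext t
  simp only [Finset.mem_image, Finset.mem_univ, true_and, decide_eq_true_eq]
  constructor
  · intro htT
    obtain ⟨i, hi⟩ := hcover t (hT.1 t htT)
    refine ⟨i, ?_⟩
    rcases hi with rfl | rfl
    · rw [if_pos htT]
    · have hnot : (![1, 2, 4, 5, 8, 10] : Fin 6 → ZMod 21) i ∉ T := fun h =>
        ((hT.2 _ (hunit i)).mp h) htT
      rw [if_neg hnot]
  · rintro ⟨i, hi⟩
    by_cases h : (![1, 2, 4, 5, 8, 10] : Fin 6 → ZMod 21) i ∈ T
    · rw [if_pos h] at hi; rw [← hi]; exact h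
    · rw [if_neg h] at hi; rw [← hi]
      by_contra hneg
      exact h (by
        have := (hT.2 _ (hunit i))
        tauto)

/-! ### §2 The census row `(ℚ(ζ₂₁), ℚ(√−7))`: UNCONDITIONAL YES -/

open scoped Classical in
/-- **CENSUS ROW `(ℚ(ζ₂₁), ℚ(√−7))` = W6.7.1 — UNCONDITIONAL: the principal CM torus `ℂ^Φ/Φ(ℤ[ζ₂₁])` CARRIES an
`ι`-compatible principal polarisation** for every CM type `Φ` of `ℚ(ζ₂₁)` balanced for
`N_{√−7} = {5, 10, 13, 17, 19, 20}`: `ζ′ = u·ζ⁵/Φ₂₁′(ζ)` with `u = ± ∏_{a∈A} c_a` the real cyclotomic unit whose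
sign at each `φ ∈ Φ` is that of `Im φ(ζ⁵/Φ₂₁′(ζ))` (§1 + parts 6/7/11) is skew, `Φ`-positive and of principal
type.  (Census b01.23 (C): the class of the Fermat sixfold `(42; 1, 14, 27)`, HC and all powers in print
[Aoki02].)  THEOREM L (ii) at `M = 21`, PROVED by explicit units.
research route conditional on HC_CM; not a corollary; Q11.4-sentence-2 already refuted in dim ≥ 3. [cite: Shimura1998, §14.3 Prop. 5, p. 104] -/
theorem exists_principal_twentyOne [IsCMField K] [IsCyclotomicExtension {21} ℚ K] (hζ : IsPrimitiveRoot ζ 21)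
    (Φ : CMType K)
    (hbal : 2 * ((Finset.univ.filter fun t : ZMod 21 =>
        ∃ σ ∈ Φ.1, σ ζ = ((ZMod.toCircle t : Circle) : ℂ)) ∩ ({5, 10, 13, 17, 19, 20} : Finset (ZMod 21))).card =
      (Finset.univ.filter fun t : ZMod 21 => ∃ σ ∈ Φ.1, σ ζ = ((ZMod.toCircle t : Circle) : ℂ)).card) :
    ∃ ζ' : K, IsCMField.complexConj K ζ' = -ζ' ∧ (∀ φ : Φ.1, 0 < (φ.1 ζ').im) ∧
        CMTypeLattice.IsOfType (1 : (FractionalIdeal (𝓞 K)⁰ K)ˣ) ζ' ⊤ := by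
  have hg : Nat.totient 21 = 2 * (5 + 1) := by decide
  have hS := isCMTypeSet_residueFilter hζ Φ
  obtain ⟨e, he⟩ := exists_signs_of_isCMTypeSet hS
  rw [he] at hbal
  obtain ⟨A, hA, ε, hAε⟩ := cover_even_patterns_twentyOne e hbal
  rw [Finset.mem_powerset] at hA
  obtain ⟨u, hu, hconj⟩ := exists_units_coe_eq hζ hA ε
  refine (exists_pos_isOfType_iff_exists_units Φ 1 (complexConj_xi hζ hg) (xi_ne_zero hζ 5)
    (isOfType_one_xi_top hζ 5)).mpr ⟨u, hconj, fun φ => ?_⟩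
  obtain ⟨t, ht, hφt⟩ := exists_apply_eq_toCircle hζ φ.1
  have htS : t ∈ (Finset.univ.image fun i : Fin 6 =>
      if e i then (![1, 2, 4, 5, 8, 10] : Fin 6 → ZMod 21) i else -(![1, 2, 4, 5, 8, 10] : Fin 6 → ZMod 21) i) := by
    rw [← he]; exact Finset.mem_filter.mpr ⟨Finset.mem_univ _, φ.1, φ.2, hφt⟩
  have hpat := hAε t htS
  have hxi : (φ.1 (ζ ^ 5 * (aeval ζ (derivative (cyclotomic 21 ℚ)))⁻¹)).im < 0 ↔
      t ∈ ({1, 4, 8, 11, 16, 19} : Finset (ZMod 21)) := by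
    rw [im_embedding_xi_neg_iff hζ hg hφt, ← nodd_twentyOne_eq]
    simp only [Finset.mem_filter, Finset.mem_univ, true_and]
    exact ⟨fun h => ⟨ht, h⟩, fun h => h.2⟩
  have hA' : ∀ a ∈ A, 0 < a ∧ a.Coprime 21 := fun a haA =>
    ⟨(gens_arith a (hA haA)).1, (gens_arith a (hA haA)).2.1⟩
  obtain ⟨hure, hune⟩ := re_embedding_prod_neg_iff hφt ht A hA' ε
  rw [← hu] at hure hune
  have hxine := im_embedding_ne_zero_of_skew (complexConj_xi hζ hg) (xi_ne_zero hζ 5) φ.1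
  have hiff : (φ.1 ((u : 𝓞 K) : K)).re < 0 ↔
      (φ.1 (ζ ^ 5 * (aeval ζ (derivative (cyclotomic 21 ℚ)))⁻¹)).im < 0 := by
    rw [hure, hpat, hxi]
  rcases lt_or_gt_of_ne hxine with hlt | hgt
  · exact mul_pos_of_neg_of_neg (hiff.mpr hlt) hlt
  · exact mul_pos (lt_of_le_of_ne (not_lt.mp fun h => (lt_asymm (hiff.mp h)) hgt) hune.symm) hgt

end Summit.HodgeConjecture.Ring2WeilCoverage.CyclotomicTwentyOneSignatures

end
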